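import Summits.Parity.BatemanHorn.Theses.SelbergDelangeRigidity
import Summits.Parity.BatemanHorn.Theorems.SystemLSDRealSegment.Negative.OmegaWide

/-!
# `LSDRealSegment` — the law on any real segment reaching past `y = 2` is false (the wall at `2`)

A refuted natural strengthening of the crux `Summit.Parity.BatemanHorn.Theses.SelbergDelangeRigidity.LSDRealSegment`
(stmt-Parity-9770), from the standing disprover's work file `Cruxes/LSDRealSegment/Disproof.lean` §5.

For the un-capped `Ω` the `p = 2` local factor of the conjectural limit `λ_f` is `E_2(z) = Σ_v P(v_2 = v) z^v`,
radius of convergence EXACTLY `2` for `f = X` (`E_2(z) = (1 - 1/2)/(1 - z/2)`), so the law cannot survive on a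
segment reaching past `2`: the crux with `7/4` replaced by ANY `b > 2` (ball `|z| < 2` and `Λ 0 = C(f)` unchanged)
is FALSE, witness the Bateman–Horn system `![X]` and `y = min((2+b)/2, 3)`: along `x = 2^m` the single term
`n = 2^m` gives a normalised sum `≥ (y/2)^m/(m log 2)^3 → ∞` (`not_lsdRealSegment_wide`). The margin `7/4 < 2`
of the crux is essential; the open segment `(5/4, 2)` is conjecturally still fine, while the endpoint `y = 2` itself
also fails (sharp form: `WallAtTwoSharp.lean`). (`isBatemanHornSystem_X` is imported from the capped sibling's
`Theorems/SystemLSDRealSegment/Negative/OmegaWide.lean`, whose `not_omegaLawWide` is the case `b = 5/2`, ball radius `3`.)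
-/

open Filter Polynomial Finset
open scoped Topology

namespace Summit.Parity.BatemanHorn.Theorems.LSDRealSegment.Negative

open Literature.NumberTheory.Sieve
open Summit.Parity.BatemanHorn.Theorems.SystemLSDRealSegment.Negative
open ArithmeticFunction (cardFactors)

/-- `Ω(2^m) = m` for the family `![X]`. [folklore] -/
theorem cardFactorsStat_X_two_pow (m : ℕ) :
    (∑ i, cardFactors ((((![X] : Fin 1 → ℤ[X]) i).eval ((2 ^ m : ℕ) : ℤ)).toNat)) = m := by
  simp only [Fin.sum_univ_one, Matrix.cons_val_fin_one, eval_X, Int.toNat_natCast]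
  exact ArithmeticFunction.cardFactors_apply_prime_pow Nat.prime_two

/-- Lower bound along `x = 2^m` for `2 < y < 4`: the real Ω-normalised sum of `![X]` is `≥ (y/2)^m / (m log 2)^3`
(keep the single term `n = 2^m`; `(log 2^m)^{1-y} = (m log 2)^{1-y} ≥ (m log 2)^{-3}`). [folklore] -/
theorem omegaNormSum_X_two_pow_ge {y : ℝ} (hy2 : 2 < y) (hy4 : y < 4) {m : ℕ} (hm : 2 ≤ m) :
    (y / 2) ^ m / ((m : ℝ) * Real.log 2) ^ 3 ≤
      ((2 ^ m : ℕ) : ℝ)⁻¹ * Real.exp ((1 : ℕ) * (1 - y) * Real.log (Real.log ((2 ^ m : ℕ) : ℝ))) *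
        ∑ n ∈ Finset.range (2 ^ m + 1), y ^ (∑ i, cardFactors ((((![X] : Fin 1
            → ℤ[X]) i).eval (n : ℤ)).toNat)) := by
  have hlog2 : (1 : ℝ) / 2 < Real.log 2 := by have := Real.log_two_gt_d9; linarith
  have hm' : (2 : ℝ) ≤ m := by exact_mod_cast hm
  have ht : 1 ≤ (m : ℝ) * Real.log 2 := by nlinarith
  have ht0 : 0 < (m : ℝ) * Real.log 2 := by linarith
  have hlogpow : Real.log ((2 ^ m : ℕ) : ℝ) = m * Real.log 2 := by push_cast; rw [Real.log_pow]
  have hexp : Real.exp ((1 : ℕ) * (1 - y) * Real.log (Real.log ((2 ^ m : ℕ) : ℝ))) =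
      ((m : ℝ) * Real.log 2) ^ (1 - y) := by
    rw [hlogpow, Real.rpow_def_of_pos ht0]
    congr 1
    push_cast
    ring
  have hexp_ge : (((m : ℝ) * Real.log 2) ^ 3)⁻¹ ≤ ((m : ℝ) * Real.log 2) ^ (1 - y) := by
    rw [← Real.rpow_natCast, ← Real.rpow_neg ht0.le]
    exact Real.rpow_le_rpow_of_exponent_le ht (by push_cast; linarith)
  have hy0 : 0 ≤ y := by linarith
  have hsum : y ^ m ≤ ∑ n ∈ Finset.range (2 ^ m + 1), y ^ (∑ i, cardFactors ((((![X] : Fin 1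
      → ℤ[X]) i).eval (n : ℤ)).toNat)) := by
    have e := cardFactorsStat_X_two_pow m
    have := Finset.single_le_sum (f := fun n : ℕ => y ^ (∑ i, cardFactors ((((![X] : Fin 1
        → ℤ[X]) i).eval (n : ℤ)).toNat)))
      (fun _ _ => by positivity) (Finset.mem_range.2 (Nat.lt_succ_self (2 ^ m)))
    rwa [e] at this
  have hx : ((2 ^ m : ℕ) : ℝ)⁻¹ = (1 / 2 : ℝ) ^ m := by push_cast; simp
  calc (y / 2) ^ m / ((m : ℝ) * Real.log 2) ^ 3
      = (1 / 2 : ℝ) ^ m * (((m : ℝ) * Real.log 2) ^ 3)⁻¹ * y ^ m := by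
        rw [div_eq_mul_inv, show y / 2 = 1 / 2 * y by ring, mul_pow]; ring
    _ ≤ (1 / 2 : ℝ) ^ m * ((m : ℝ) * Real.log 2) ^ (1 - y) *
          ∑ n ∈ Finset.range (2 ^ m + 1), y ^ (∑ i, cardFactors ((((![X] : Fin 1
              → ℤ[X]) i).eval (n : ℤ)).toNat)) := by
        gcongr
    _ = _ := by rw [hx, hexp]

/-- `(y/2)^m / (m log 2)^3 → ∞` for `y > 2`. [folklore] -/
theorem tendsto_geom_div_cube {y : ℝ} (hy2 : 2 < y) :
    Tendsto (fun m : ℕ => (y / 2) ^ m / ((m : ℝ) * Real.log 2) ^ 3) atTop atTop := by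
  have hr : 1 < y / 2 := by linarith
  have h0 : Tendsto (fun m : ℕ => (m : ℝ) ^ 3 / (y / 2) ^ m) atTop (𝓝[>] 0) := by
    refine tendsto_nhdsWithin_iff.2 ⟨tendsto_pow_const_div_const_pow_of_one_lt 3 hr, ?_⟩
    filter_upwards [eventually_ge_atTop 1] with m hm
    simp only [Set.mem_Ioi]
    positivity
  have h1 := h0.inv_tendsto_nhdsGT_zero
  have h2 := h1.const_mul_atTop (by have := Real.log_two_gt_d9; positivity : (0 : ℝ) < (Real.log 2 ^ 3)⁻¹)
  refine h2.congr' ?_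
  filter_upwards [eventually_ge_atTop 1] with m hm
  have hm0 : (m : ℝ) ≠ 0 := by exact_mod_cast (show m ≠ 0 by omega)
  have hl : Real.log 2 ≠ 0 := by have := Real.log_two_gt_d9; positivity
  have hy0 : y / 2 ≠ 0 := by positivity
  simp only [Pi.inv_apply]
  field_simp

/-- THE LAW ON ANY SEGMENT REACHING PAST 2 IS FALSE: the crux with `7/4` replaced by any `b > 2` (everything else —
the ball `|z| < 2`, `Λ 0 = C(f)` — unchanged) fails. Witness `k = 1`, `f = ![X]` (a Bateman–Horn system) and
`y = min ((2+b)/2) 3 ∈ (2, b)`: along `x = 2^m`, `H_x(y) ≥ (y/2)^m/(m log 2)^3 → ∞`. [folklore] -/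
theorem not_lsdRealSegment_wide {b : ℝ} (hb : 2 < b) :
    ¬ ∀ (k : ℕ) (f : Fin k → ℤ[X]), IsBatemanHornSystem f → ∃ Λ : ℂ → ℂ, DifferentiableOn ℂ Λ (Metric.ball 0 2) ∧
      Λ 0 = (batemanHornConst f : ℂ) ∧ ∀ y : ℝ, 5 / 4 < y → y < b →
        Filter.Tendsto (fun x : ℕ => (x : ℂ)⁻¹
            * Complex.exp ((k : ℂ) * (1 - (y : ℂ)) * (Real.log (Real.log x) : ℂ)) *
          ∑ n ∈ Finset.range (x + 1), (y : ℂ) ^ (∑ i, cardFactors (((f i).eval (n : ℤ)).toNat))) Filter.atTop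
          (nhds (Λ y * Complex.exp (((y : ℂ) - 1) * (Real.log (∏ i, ((f i).natDegree : ℝ)) : ℂ)) *
            (Complex.Gamma y)⁻¹ ^ k)) := by
  intro h
  obtain ⟨Λ, _, _, hlaw⟩ := h 1 ![X] isBatemanHornSystem_X
  set y : ℝ := min ((2 + b) / 2) 3 with hy
  have hy2 : 2 < y := by rw [hy]; exact lt_min (by linarith) (by norm_num)
  have hy4 : y < 4 := by rw [hy]; exact (min_le_right _ _).trans_lt (by norm_num)
  have hyb : y < b := by rw [hy]; exact (min_le_left _ _).trans_lt (by linarith)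
  have hofReal : ∀ x : ℕ, (x : ℂ)⁻¹ * Complex.exp (((1 : ℕ) : ℂ) * (1 - (y : ℂ)) *
      (Real.log (Real.log x) : ℂ)) * ∑ n ∈ Finset.range (x + 1), (y : ℂ) ^ (∑ i, cardFactors ((((![X] : Fin 1
          → ℤ[X]) i).eval (n : ℤ)).toNat)) =
      (((x : ℝ)⁻¹ * Real.exp ((1 : ℕ) * (1 - y) * Real.log (Real.log x)) *
        ∑ n ∈ Finset.range (x + 1), y ^ (∑ i, cardFactors ((((![X] : Fin 1
            → ℤ[X]) i).eval (n : ℤ)).toNat)) : ℝ) : ℂ) := fun x => by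
    push_cast
    rfl
  have hlim := (hlaw y (by linarith) hyb).congr hofReal
  have hre := tendsto_re_of_tendsto_ofReal hlim
  have h2m : Tendsto (fun m : ℕ => 2 ^ m) atTop atTop := tendsto_pow_atTop_atTop_of_one_lt one_lt_two
  refine not_tendsto_atTop_of_tendsto_nhds (hre.comp h2m) ?_
  refine tendsto_atTop_mono' atTop ?_ (tendsto_geom_div_cube hy2)
  filter_upwards [eventually_ge_atTop 2] with m hm
  exact omegaNormSum_X_two_pow_ge hy2 hy4 hm

/-- Certificate: with `b = 7/4` the refuted statement would be the route decl verbatim (so the crux sits at distance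
`1/4` from the wall). -/
example : Summit.Parity.BatemanHorn.Theses.SelbergDelangeRigidity.LSDRealSegment ↔
    ∀ (k : ℕ) (f : Fin k → ℤ[X]), IsBatemanHornSystem f → ∃ Λ : ℂ → ℂ, DifferentiableOn ℂ Λ (Metric.ball 0 2) ∧
      Λ 0 = (batemanHornConst f : ℂ) ∧ ∀ y : ℝ, 5 / 4 < y → y < 7 / 4 →
        Filter.Tendsto (fun x : ℕ => (x : ℂ)⁻¹
            * Complex.exp ((k : ℂ) * (1 - (y : ℂ)) * (Real.log (Real.log x) : ℂ)) *
          ∑ n ∈ Finset.range (x + 1), (y : ℂ) ^ (∑ i, ArithmeticFunction.cardFactors (((f i).eval (n : ℤ)).toNat)))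
          Filter.atTop (nhds (Λ y * Complex.exp (((y : ℂ) - 1) * (Real.log (∏ i, ((f i).natDegree : ℝ)) : ℂ)) *
            (Complex.Gamma y)⁻¹ ^ k)) :=
  Iff.rfl

end Summit.Parity.BatemanHorn.Theorems.LSDRealSegment.Negative
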